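import Summits.CriticalPhenomena.PercolationContinuityZ3.Theorems.SahiMasterFamilyCrossOrbitEvents
import Summits.CriticalPhenomena.PercolationContinuityZ3.Theorems.PercNearOneGluingNoHeavyLowerTailSahiCombJunta
import HarnessLib

/-!
# Kahn's `C₃` / Sahi's `C₃` for "triangle" triples sharing at most two coordinates

Unit `prim-master-conj` (crux anchor stmt-CriticalPhenomena-4575, helper work), gen 38; memo
`run/shared/lean/prim/prim-l12/prim-master-conj/POINTWISE.md` §39 and `prim-l12/FROM-prim-master-conj-g38-TRIANGLE-RECURSION.md`.

THEOREM C (`sahiE_three_ind_nonneg_of_supports₂`).  Let `U₀, U₁, U₂` be increasing events on a finite product of two-point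
spaces with product measure `μ_p`, `U₀` determined by `S`, `U₁` by `T`, `S ∩ T ⊆ {e, e'}`, and `U₂` free of `e` and `e'`.  Then
`E_3(μ_p; 1_{U₀}, 1_{U₁}, 1_{U₂}) ≥ 0`.  (Gen 37's `MixedRectangle.sahiE_three_ind_nonneg_of_supports` is the case
`S ∩ T ⊆ {e}`; in the language of the memo: Sahi's `C₃` holds for all triangle-graphical triples `f(x,y), g(x,z), h(y,z)` with
`|X| ≤ 2`.)  Proof: `E_3` is a biquadratic polynomial in `(p_e, p_{e'})` whose nine Bernstein coefficients are, in terms of the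
double sections `a_x = U₀^{x}`, `b_x = U₁^{x}` (`x ∈ {0,1}²`) and `W = U₂`: four two-Harris quantities `D_x`, four two-rectangle
quantities `T` (nested orbits) and the (Ψ₂) orbit sum `CROSS` (`sahiE_three_eq_bernstein₂`); all are `≥ 0`
(`CrossOrbit.cross_nonneg_of_determinedBy`, the `T`'s being its degenerate case of a family constant in one direction).
HONEST FRAMING: a new certified region of Kahn's Conjecture 5 / Sahi's `C₃` (all triples with no coordinate common to the three
supports and some two supports meeting in ≤ 2 coordinates); the conjecture remains OPEN. [this work]
-/

noncomputable section

open scoped Classical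

namespace Summit.CriticalPhenomena.PercolationContinuityZ3.Theorems

namespace CrossOrbit

open Finset Function
open Literature.Combinatorics.Sahi2008
open Literature.Probability.Percolation (DeterminedBy)
open Literature.Probability.Percolation.DecisionTree (ind ind_nonneg ind_of_mem ind_of_not_mem)
open Literature.Probability.LatticeModels (prodBernoulli prodBernoulli_real_inter_of_determinedBy_disjoint)

variable {ι : Type} [Fintype ι]

local notation3 (prettyPrint := false) "μ⟦" q ", " X "⟧" => ex (bernoulliWeight q) (ind X)

/-- The section moment of an indicator is the expectation of the section's indicator. [this work] -/
private theorem secEx_ind_eq' (p : ι → unitInterval) (e : ι) (X : Set (Set ι)) (bb : Bool) :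
    secEx p e (ind X) bb = μ⟦p, secAt e bb X⟧ := by
  have h1 : secEx p e (ind X) bb = ex (bernoulliWeight (update p e (boolParam bb))) (ind X) := by
    rw [ex_update_eq]
    cases bb <;> simp [boolParam]
  rw [h1, ex_ind_update_boolParam, ex_update_eq_of_ignores p e (boolParam bb) (p e) (ind_secAt_insert e bb X),
    update_eq_self]

/-- Expectation split along a coordinate at the current parameter: `μ⟦X⟧ = p_e'·μ⟦X^1⟧ + (1 − p_e')·μ⟦X^0⟧`. [this work] -/
private theorem ex_ind_split (p : ι → unitInterval) (e' : ι) (X : Set (Set ι)) :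
    μ⟦p, X⟧ = (↑(p e') : ℝ) * μ⟦p, secAt e' true X⟧ + (1 - (↑(p e') : ℝ)) * μ⟦p, secAt e' false X⟧ := by
  have h := ex_update_eq p e' (p e') (ind X)
  rw [update_eq_self] at h
  rw [h, secEx_ind_eq', secEx_ind_eq']

omit [Fintype ι] in
/-- Sections are monotone in the event. [folklore] -/
private theorem secAt_mono' (x : ι) (bb : Bool) {A B : Set (Set ι)} (h : A ⊆ B) : secAt x bb A ⊆ secAt x bb B :=
  fun ω hω => by rw [mem_secAt] at hω ⊢; exact h hω

/-- **The biquadratic Bernstein form of `E_3` along two coordinates free for the third event.**  With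
`a_x = U₀` sectioned at `(e, e') = x`, `b_x` likewise for `U₁`, `W = U₂` (free of `e, e'`), `s = p_e`, `t = p_e'`, and
independent double sections (`μ⟦a_x ∩ b_x⟧ = μ⟦a_x⟧μ⟦b_x⟧`):
`E_3 = Σ_x s-weight·t-weight·D_x + Σ_(nested pairs) (…)·2ψ + s(1−s)t(1−t)·CROSS`. [this work] -/
theorem sahiE_three_eq_bernstein₂ (p : ι → unitInterval) (e e' : ι) (U : Fin 3 → Set (Set ι))
    (hfree : ∀ c : Bool, secAt e c (U 2) = U 2) (hfree' : ∀ c : Bool, secAt e' c (U 2) = U 2)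
    (hind : ∀ c d : Bool, μ⟦p, secAt e' d (secAt e c (U 0)) ∩ secAt e' d (secAt e c (U 1))⟧
      = μ⟦p, secAt e' d (secAt e c (U 0))⟧ * μ⟦p, secAt e' d (secAt e c (U 1))⟧) :
    sahiE (bernoulliWeight p) 3 (fun j => ind (U j)) =
      (1 - (↑(p e) : ℝ)) ^ 2 * (1 - (↑(p e') : ℝ)) ^ 2 * (2 * μ⟦p, secAt e' false (secAt e false (U 0)) ∩ secAt e' false (secAt e false (U 1)) ∩ U 2⟧ - μ⟦p,
      secAt e' false (secAt e false (U 0))⟧ * μ⟦p, secAt e' false (secAt e false (U 1)) ∩ U 2⟧ - μ⟦p, secAt e' false (secAt e false (U 1))⟧ * μ⟦p, secAt e'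
      false (secAt e false (U 0)) ∩ U 2⟧) + (1 - (↑(p e) : ℝ)) ^ 2 * (↑(p e') : ℝ) ^ 2 * (2 * μ⟦p, secAt e' true (secAt e false (U 0)) ∩ secAt e' true
      (secAt e false (U 1)) ∩ U 2⟧ - μ⟦p, secAt e' true (secAt e false (U 0))⟧ * μ⟦p, secAt e' true (secAt e false (U 1)) ∩ U 2⟧ - μ⟦p, secAt e' true (secAt
      e false (U 1))⟧ * μ⟦p, secAt e' true (secAt e false (U 0)) ∩ U 2⟧) + (↑(p e) : ℝ) ^ 2 * (1 - (↑(p e') : ℝ)) ^ 2 * (2 * μ⟦p, secAt e' false (secAt e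
      true (U 0)) ∩ secAt e' false (secAt e true (U 1)) ∩ U 2⟧ - μ⟦p, secAt e' false (secAt e true (U 0))⟧ * μ⟦p, secAt e' false (secAt e true (U 1)) ∩ U 2⟧
      - μ⟦p, secAt e' false (secAt e true (U 1))⟧ * μ⟦p, secAt e' false (secAt e true (U 0)) ∩ U 2⟧) + (↑(p e) : ℝ) ^ 2 * (↑(p e') : ℝ) ^ 2 * (2 * μ⟦p,
      secAt e' true (secAt e true (U 0)) ∩ secAt e' true (secAt e true (U 1)) ∩ U 2⟧ - μ⟦p, secAt e' true (secAt e true (U 0))⟧ * μ⟦p, secAt e' true (secAt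
      e true (U 1)) ∩ U 2⟧ - μ⟦p, secAt e' true (secAt e true (U 1))⟧ * μ⟦p, secAt e' true (secAt e true (U 0)) ∩ U 2⟧) + (1 - (↑(p e) : ℝ)) ^ 2 * ((↑(p e')
      : ℝ) * (1 - (↑(p e') : ℝ))) * (2 * μ⟦p, secAt e' false (secAt e false (U 0)) ∩ secAt e' false (secAt e false (U 1)) ∩ U 2⟧ + 2 * μ⟦p, secAt e' true
      (secAt e false (U 0)) ∩ secAt e' true (secAt e false (U 1)) ∩ U 2⟧ - μ⟦p, secAt e' false (secAt e false (U 0))⟧ * μ⟦p, secAt e' true (secAt e false (U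
      1)) ∩ U 2⟧ - μ⟦p, secAt e' true (secAt e false (U 0))⟧ * μ⟦p, secAt e' false (secAt e false (U 1)) ∩ U 2⟧ - μ⟦p, secAt e' false (secAt e false (U 1))⟧
      * μ⟦p, secAt e' true (secAt e false (U 0)) ∩ U 2⟧ - μ⟦p, secAt e' true (secAt e false (U 1))⟧ * μ⟦p, secAt e' false (secAt e false (U 0)) ∩ U 2⟧ -
      μ⟦p, U 2⟧ * (μ⟦p, secAt e' false (secAt e false (U 0))⟧ - μ⟦p, secAt e' true (secAt e false (U 0))⟧) * (μ⟦p, secAt e' false (secAt e false (U 1))⟧ -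
      μ⟦p, secAt e' true (secAt e false (U 1))⟧)) + (↑(p e) : ℝ) ^ 2 * ((↑(p e') : ℝ) * (1 - (↑(p e') : ℝ))) * (2 * μ⟦p, secAt e' false (secAt e true (U 0))
      ∩ secAt e' false (secAt e true (U 1)) ∩ U 2⟧ + 2 * μ⟦p, secAt e' true (secAt e true (U 0)) ∩ secAt e' true (secAt e true (U 1)) ∩ U 2⟧ - μ⟦p, secAt e'
      false (secAt e true (U 0))⟧ * μ⟦p, secAt e' true (secAt e true (U 1)) ∩ U 2⟧ - μ⟦p, secAt e' true (secAt e true (U 0))⟧ * μ⟦p, secAt e' false (secAt e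
      true (U 1)) ∩ U 2⟧ - μ⟦p, secAt e' false (secAt e true (U 1))⟧ * μ⟦p, secAt e' true (secAt e true (U 0)) ∩ U 2⟧ - μ⟦p, secAt e' true (secAt e true (U
      1))⟧ * μ⟦p, secAt e' false (secAt e true (U 0)) ∩ U 2⟧ - μ⟦p, U 2⟧ * (μ⟦p, secAt e' false (secAt e true (U 0))⟧ - μ⟦p, secAt e' true (secAt e true (U
      0))⟧) * (μ⟦p, secAt e' false (secAt e true (U 1))⟧ - μ⟦p, secAt e' true (secAt e true (U 1))⟧)) + ((↑(p e) : ℝ) * (1 - (↑(p e) : ℝ))) * (1 - (↑(p e')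
      : ℝ)) ^ 2 * (2 * μ⟦p, secAt e' false (secAt e false (U 0)) ∩ secAt e' false (secAt e false (U 1)) ∩ U 2⟧ + 2 * μ⟦p, secAt e' false (secAt e true (U
      0)) ∩ secAt e' false (secAt e true (U 1)) ∩ U 2⟧ - μ⟦p, secAt e' false (secAt e false (U 0))⟧ * μ⟦p, secAt e' false (secAt e true (U 1)) ∩ U 2⟧ - μ⟦p,
      secAt e' false (secAt e true (U 0))⟧ * μ⟦p, secAt e' false (secAt e false (U 1)) ∩ U 2⟧ - μ⟦p, secAt e' false (secAt e false (U 1))⟧ * μ⟦p, secAt e'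
      false (secAt e true (U 0)) ∩ U 2⟧ - μ⟦p, secAt e' false (secAt e true (U 1))⟧ * μ⟦p, secAt e' false (secAt e false (U 0)) ∩ U 2⟧ - μ⟦p, U 2⟧ * (μ⟦p,
      secAt e' false (secAt e false (U 0))⟧ - μ⟦p, secAt e' false (secAt e true (U 0))⟧) * (μ⟦p, secAt e' false (secAt e false (U 1))⟧ - μ⟦p, secAt e' false
      (secAt e true (U 1))⟧)) + ((↑(p e) : ℝ) * (1 - (↑(p e) : ℝ))) * (↑(p e') : ℝ) ^ 2 * (2 * μ⟦p, secAt e' true (secAt e false (U 0)) ∩ secAt e' true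
      (secAt e false (U 1)) ∩ U 2⟧ + 2 * μ⟦p, secAt e' true (secAt e true (U 0)) ∩ secAt e' true (secAt e true (U 1)) ∩ U 2⟧ - μ⟦p, secAt e' true (secAt e
      false (U 0))⟧ * μ⟦p, secAt e' true (secAt e true (U 1)) ∩ U 2⟧ - μ⟦p, secAt e' true (secAt e true (U 0))⟧ * μ⟦p, secAt e' true (secAt e false (U 1)) ∩
      U 2⟧ - μ⟦p, secAt e' true (secAt e false (U 1))⟧ * μ⟦p, secAt e' true (secAt e true (U 0)) ∩ U 2⟧ - μ⟦p, secAt e' true (secAt e true (U 1))⟧ * μ⟦p,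
      secAt e' true (secAt e false (U 0)) ∩ U 2⟧ - μ⟦p, U 2⟧ * (μ⟦p, secAt e' true (secAt e false (U 0))⟧ - μ⟦p, secAt e' true (secAt e true (U 0))⟧) *
      (μ⟦p, secAt e' true (secAt e false (U 1))⟧ - μ⟦p, secAt e' true (secAt e true (U 1))⟧)) + ((↑(p e) : ℝ) * (1 - (↑(p e) : ℝ))) * ((↑(p e') : ℝ) * (1 -
      (↑(p e') : ℝ))) * ((2 * μ⟦p, secAt e' false (secAt e false (U 0)) ∩ secAt e' false (secAt e false (U 1)) ∩ U 2⟧ + 2 * μ⟦p, secAt e' true (secAt e true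
      (U 0)) ∩ secAt e' true (secAt e true (U 1)) ∩ U 2⟧ - μ⟦p, secAt e' false (secAt e false (U 0))⟧ * μ⟦p, secAt e' true (secAt e true (U 1)) ∩ U 2⟧ -
      μ⟦p, secAt e' true (secAt e true (U 0))⟧ * μ⟦p, secAt e' false (secAt e false (U 1)) ∩ U 2⟧ - μ⟦p, secAt e' false (secAt e false (U 1))⟧ * μ⟦p, secAt
      e' true (secAt e true (U 0)) ∩ U 2⟧ - μ⟦p, secAt e' true (secAt e true (U 1))⟧ * μ⟦p, secAt e' false (secAt e false (U 0)) ∩ U 2⟧ - μ⟦p, U 2⟧ * (μ⟦p,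
      secAt e' false (secAt e false (U 0))⟧ - μ⟦p, secAt e' true (secAt e true (U 0))⟧) * (μ⟦p, secAt e' false (secAt e false (U 1))⟧ - μ⟦p, secAt e' true
      (secAt e true (U 1))⟧)) + (2 * μ⟦p, secAt e' true (secAt e false (U 0)) ∩ secAt e' true (secAt e false (U 1)) ∩ U 2⟧ + 2 * μ⟦p, secAt e' false (secAt
      e true (U 0)) ∩ secAt e' false (secAt e true (U 1)) ∩ U 2⟧ - μ⟦p, secAt e' true (secAt e false (U 0))⟧ * μ⟦p, secAt e' false (secAt e true (U 1)) ∩ U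
      2⟧ - μ⟦p, secAt e' false (secAt e true (U 0))⟧ * μ⟦p, secAt e' true (secAt e false (U 1)) ∩ U 2⟧ - μ⟦p, secAt e' true (secAt e false (U 1))⟧ * μ⟦p,
      secAt e' false (secAt e true (U 0)) ∩ U 2⟧ - μ⟦p, secAt e' false (secAt e true (U 1))⟧ * μ⟦p, secAt e' true (secAt e false (U 0)) ∩ U 2⟧ - μ⟦p, U 2⟧ *
      (μ⟦p, secAt e' true (secAt e false (U 0))⟧ - μ⟦p, secAt e' false (secAt e true (U 0))⟧) * (μ⟦p, secAt e' true (secAt e false (U 1))⟧ - μ⟦p, secAt e'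
      false (secAt e true (U 1))⟧))) := by
  have hE : sahiE (bernoulliWeight p) 3 (fun j => ind (U j)) = cubicE3 p e (ind (U 0)) (ind (U 1)) (ind (U 2)) (↑(p e) : ℝ) := by
    have h := SahiLogDerivEnd.sahiE_three_ind_update_eq p e (p e) U
    rwa [update_eq_self] at h
  have hprod : ∀ (A B : Set (Set ι)), ind A * ind B = ind (A ∩ B) := fun A B => ind_mul_ind_eq_inter A B
  rw [hE]
  simp only [cubicE3, hprod, secEx_ind_eq', secAt_inter, hfree]
  rw [ex_ind_split p e' (secAt e true (U 0)), ex_ind_split p e' (secAt e false (U 0)),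
    ex_ind_split p e' (secAt e true (U 1)), ex_ind_split p e' (secAt e false (U 1)),
    ex_ind_split p e' (secAt e true (U 0) ∩ secAt e true (U 1)), ex_ind_split p e' (secAt e false (U 0) ∩ secAt e false (U 1)),
    ex_ind_split p e' (secAt e true (U 0) ∩ U 2), ex_ind_split p e' (secAt e false (U 0) ∩ U 2),
    ex_ind_split p e' (secAt e true (U 1) ∩ U 2), ex_ind_split p e' (secAt e false (U 1) ∩ U 2),
    ex_ind_split p e' (secAt e true (U 0) ∩ secAt e true (U 1) ∩ U 2), ex_ind_split p e' (secAt e false (U 0) ∩ secAt e false (U 1) ∩ U 2)]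
  simp only [secAt_inter, hfree', hind]
  ring

set_option maxHeartbeats 4000000 in
/-- **KAHN'S `C₃` / SAHI'S `C₃` WHEN THE SUPPORTS OF TWO OF THE THREE EVENTS MEET IN AT MOST TWO COORDINATES (and the third event avoids them).** [this work] -/
theorem sahiE_three_ind_nonneg_of_supports₂ (p : ι → unitInterval) (e e' : ι) {U : Fin 3 → Set (Set ι)}
    (hU : ∀ j, IsUpperSet (U j)) {S T : Finset ι} (hS : DeterminedBy (U 0) (↑S : Set ι))
    (hT : DeterminedBy (U 1) (↑T : Set ι)) (hST : S ∩ T ⊆ {e, e'})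
    (hfree : ∀ c : Bool, secAt e c (U 2) = U 2) (hfree' : ∀ c : Bool, secAt e' c (U 2) = U 2) :
    0 ≤ sahiE (bernoulliWeight p) 3 (fun j => ind (U j)) := by
  -- the double sections, their monotonicity, supports and independence
  have hup : ∀ (j : Fin 3) (c d : Bool), IsUpperSet (secAt e' d (secAt e c (U j))) := fun j c d =>
    isUpperSet_secAt e' d (isUpperSet_secAt e c (hU j))
  have hW : IsUpperSet (U 2) := hU 2
  have hmon_e : ∀ (j : Fin 3) (d : Bool), secAt e' d (secAt e false (U j)) ⊆ secAt e' d (secAt e true (U j)) :=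
    fun j d => secAt_mono' e' d (secAt_false_subset_true (hU j) e)
  have hmon_e' : ∀ (j : Fin 3) (c : Bool), secAt e' false (secAt e c (U j)) ⊆ secAt e' true (secAt e c (U j)) :=
    fun j c => secAt_false_subset_true (isUpperSet_secAt e c (hU j)) e'
  have hdisj : Disjoint ((S.erase e).erase e') ((T.erase e).erase e') := by
    rw [Finset.disjoint_left]
    intro i hiS hiT
    have hi : i ∈ S ∩ T := Finset.mem_inter.2 ⟨Finset.mem_of_mem_erase (Finset.mem_of_mem_erase hiS),
      Finset.mem_of_mem_erase (Finset.mem_of_mem_erase hiT)⟩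
    have h2 := hST hi
    rw [Finset.mem_insert, Finset.mem_singleton] at h2
    rcases h2 with h2 | h2
    · exact Finset.ne_of_mem_erase (Finset.mem_of_mem_erase hiS) h2
    · exact Finset.ne_of_mem_erase hiS h2
  have hdS : ∀ c d : Bool, DeterminedBy (secAt e' d (secAt e c (U 0))) (↑((S.erase e).erase e') : Set ι) := fun c d =>
    determinedBy_secAt e' d (determinedBy_secAt e c hS)
  have hdT : ∀ c d : Bool, DeterminedBy (secAt e' d (secAt e c (U 1))) (↑((T.erase e).erase e') : Set ι) := fun c d =>
    determinedBy_secAt e' d (determinedBy_secAt e c hT)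
  have hind : ∀ c d : Bool, μ⟦p, secAt e' d (secAt e c (U 0)) ∩ secAt e' d (secAt e c (U 1))⟧
      = μ⟦p, secAt e' d (secAt e c (U 0))⟧ * μ⟦p, secAt e' d (secAt e c (U 1))⟧ := by
    intro c d
    rw [ex_bernoulliWeight_ind, ex_bernoulliWeight_ind, ex_bernoulliWeight_ind]
    exact prodBernoulli_real_inter_of_determinedBy_disjoint p hdisj (hdS c d) (hdT c d) MeasurableSet.of_discrete
      MeasurableSet.of_discrete
  rw [sahiE_three_eq_bernstein₂ p e e' U hfree hfree' hind]
  have hs0 : 0 ≤ (↑(p e) : ℝ) := (p e).2.1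
  have hs1 : (↑(p e) : ℝ) ≤ 1 := (p e).2.2
  have ht0 : 0 ≤ (↑(p e') : ℝ) := (p e').2.1
  have ht1 : (↑(p e') : ℝ) ≤ 1 := (p e').2.2
  have hD_00 : 0 ≤ (2 * μ⟦p, secAt e' false (secAt e false (U 0)) ∩ secAt e' false (secAt e false (U 1)) ∩ U 2⟧ - μ⟦p, secAt e' false (secAt e false (U 0))⟧ * μ⟦p, secAt e' false (secAt e false (U 1)) ∩ U 2⟧ - μ⟦p, secAt e' false (secAt e false (U 1))⟧ * μ⟦p, secAt e' false (secAt e false (U 0)) ∩ U 2⟧) := by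
    have h1 := harris_ex_ind p (hup 0 false false) ((hup 1 false false).inter hW)
    have h2 := harris_ex_ind p (hup 1 false false) ((hup 0 false false).inter hW)
    rw [← Set.inter_assoc] at h1
    rw [← Set.inter_assoc, Set.inter_comm (secAt e' false (secAt e false (U 1))) (secAt e' false (secAt e false (U 0)))] at h2
    linarith
  have hD_01 : 0 ≤ (2 * μ⟦p, secAt e' true (secAt e false (U 0)) ∩ secAt e' true (secAt e false (U 1)) ∩ U 2⟧ - μ⟦p, secAt e' true (secAt e false (U 0))⟧ * μ⟦p, secAt e' true (secAt e false (U 1)) ∩ U 2⟧ - μ⟦p, secAt e' true (secAt e false (U 1))⟧ * μ⟦p, secAt e' true (secAt e false (U 0)) ∩ U 2⟧) := by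
    have h1 := harris_ex_ind p (hup 0 false true) ((hup 1 false true).inter hW)
    have h2 := harris_ex_ind p (hup 1 false true) ((hup 0 false true).inter hW)
    rw [← Set.inter_assoc] at h1
    rw [← Set.inter_assoc, Set.inter_comm (secAt e' true (secAt e false (U 1))) (secAt e' true (secAt e false (U 0)))] at h2
    linarith
  have hD_10 : 0 ≤ (2 * μ⟦p, secAt e' false (secAt e true (U 0)) ∩ secAt e' false (secAt e true (U 1)) ∩ U 2⟧ - μ⟦p, secAt e' false (secAt e true (U 0))⟧ * μ⟦p, secAt e' false (secAt e true (U 1)) ∩ U 2⟧ - μ⟦p, secAt e' false (secAt e true (U 1))⟧ * μ⟦p, secAt e' false (secAt e true (U 0)) ∩ U 2⟧) := by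
    have h1 := harris_ex_ind p (hup 0 true false) ((hup 1 true false).inter hW)
    have h2 := harris_ex_ind p (hup 1 true false) ((hup 0 true false).inter hW)
    rw [← Set.inter_assoc] at h1
    rw [← Set.inter_assoc, Set.inter_comm (secAt e' false (secAt e true (U 1))) (secAt e' false (secAt e true (U 0)))] at h2
    linarith
  have hD_11 : 0 ≤ (2 * μ⟦p, secAt e' true (secAt e true (U 0)) ∩ secAt e' true (secAt e true (U 1)) ∩ U 2⟧ - μ⟦p, secAt e' true (secAt e true (U 0))⟧ * μ⟦p, secAt e' true (secAt e true (U 1)) ∩ U 2⟧ - μ⟦p, secAt e' true (secAt e true (U 1))⟧ * μ⟦p, secAt e' true (secAt e true (U 0)) ∩ U 2⟧) := by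
    have h1 := harris_ex_ind p (hup 0 true true) ((hup 1 true true).inter hW)
    have h2 := harris_ex_ind p (hup 1 true true) ((hup 0 true true).inter hW)
    rw [← Set.inter_assoc] at h1
    rw [← Set.inter_assoc, Set.inter_comm (secAt e' true (secAt e true (U 1))) (secAt e' true (secAt e true (U 0)))] at h2
    linarith
  have hX : 0 ≤ ((2 * μ⟦p, secAt e' false (secAt e false (U 0)) ∩ secAt e' false (secAt e false (U 1)) ∩ U 2⟧ + 2 * μ⟦p, secAt e' true (secAt e true (U 0)) ∩ secAt e'
      true (secAt e true (U 1)) ∩ U 2⟧ - μ⟦p, secAt e' false (secAt e false (U 0))⟧ * μ⟦p, secAt e' true (secAt e true (U 1)) ∩ U 2⟧ - μ⟦p, secAt e' true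
      (secAt e true (U 0))⟧ * μ⟦p, secAt e' false (secAt e false (U 1)) ∩ U 2⟧ - μ⟦p, secAt e' false (secAt e false (U 1))⟧ * μ⟦p, secAt e' true (secAt e
      true (U 0)) ∩ U 2⟧ - μ⟦p, secAt e' true (secAt e true (U 1))⟧ * μ⟦p, secAt e' false (secAt e false (U 0)) ∩ U 2⟧ - μ⟦p, U 2⟧ * (μ⟦p, secAt e' false
      (secAt e false (U 0))⟧ - μ⟦p, secAt e' true (secAt e true (U 0))⟧) * (μ⟦p, secAt e' false (secAt e false (U 1))⟧ - μ⟦p, secAt e' true (secAt e true (U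
      1))⟧)) + (2 * μ⟦p, secAt e' true (secAt e false (U 0)) ∩ secAt e' true (secAt e false (U 1)) ∩ U 2⟧ + 2 * μ⟦p, secAt e' false (secAt e true (U 0)) ∩
      secAt e' false (secAt e true (U 1)) ∩ U 2⟧ - μ⟦p, secAt e' true (secAt e false (U 0))⟧ * μ⟦p, secAt e' false (secAt e true (U 1)) ∩ U 2⟧ - μ⟦p, secAt
      e' false (secAt e true (U 0))⟧ * μ⟦p, secAt e' true (secAt e false (U 1)) ∩ U 2⟧ - μ⟦p, secAt e' true (secAt e false (U 1))⟧ * μ⟦p, secAt e' false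
      (secAt e true (U 0)) ∩ U 2⟧ - μ⟦p, secAt e' false (secAt e true (U 1))⟧ * μ⟦p, secAt e' true (secAt e false (U 0)) ∩ U 2⟧ - μ⟦p, U 2⟧ * (μ⟦p, secAt e'
      true (secAt e false (U 0))⟧ - μ⟦p, secAt e' false (secAt e true (U 0))⟧) * (μ⟦p, secAt e' true (secAt e false (U 1))⟧ - μ⟦p, secAt e' false (secAt e
      true (U 1))⟧))) :=
    cross_nonneg_of_determinedBy p (a00 := secAt e' false (secAt e false (U 0))) (a01 := secAt e' true (secAt e false (U 0))) (a10 := secAt e' false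
    (secAt e true (U 0))) (a11 := secAt e' true (secAt e true (U 0))) (b00 := secAt e' false (secAt e false (U 1))) (b01 := secAt e' true (secAt e false
    (U 1))) (b10 := secAt e' false (secAt e true (U 1))) (b11 := secAt e' true (secAt e true (U 1))) (W := U 2) (hup 0 false false) (hup 0 false true)
    (hup 0 true false) (hup 0 true true) (hup 1 false false) (hup 1 false true) (hup 1 true false) (hup 1 true true) hW (hmon_e' 0 false) (hmon_e 0 false)
    (hmon_e 0 true) (hmon_e' 0 true) (hmon_e' 1 false) (hmon_e 1 false) (hmon_e 1 true) (hmon_e' 1 true) hdisj (hdS false false) (hdS false true) (hdS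
    true false) (hdS true true) (hdT false false) (hdT false true) (hdT true false) (hdT true true)
  have hT_00_01 : 0 ≤ (2 * μ⟦p, secAt e' false (secAt e false (U 0)) ∩ secAt e' false (secAt e false (U 1)) ∩ U 2⟧ + 2 * μ⟦p, secAt e' true (secAt e false (U 0)) ∩ secAt e'
      true (secAt e false (U 1)) ∩ U 2⟧ - μ⟦p, secAt e' false (secAt e false (U 0))⟧ * μ⟦p, secAt e' true (secAt e false (U 1)) ∩ U 2⟧ - μ⟦p, secAt e' true
      (secAt e false (U 0))⟧ * μ⟦p, secAt e' false (secAt e false (U 1)) ∩ U 2⟧ - μ⟦p, secAt e' false (secAt e false (U 1))⟧ * μ⟦p, secAt e' true (secAt e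
      false (U 0)) ∩ U 2⟧ - μ⟦p, secAt e' true (secAt e false (U 1))⟧ * μ⟦p, secAt e' false (secAt e false (U 0)) ∩ U 2⟧ - μ⟦p, U 2⟧ * (μ⟦p, secAt e' false
      (secAt e false (U 0))⟧ - μ⟦p, secAt e' true (secAt e false (U 0))⟧) * (μ⟦p, secAt e' false (secAt e false (U 1))⟧ - μ⟦p, secAt e' true (secAt e false
      (U 1))⟧)) := by
    have h := cross_nonneg_of_determinedBy p (a00 := secAt e' false (secAt e false (U 0))) (a01 := secAt e' true (secAt e false (U 0))) (a10 := secAt e' false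
      (secAt e false (U 0))) (a11 := secAt e' true (secAt e false (U 0))) (b00 := secAt e' false (secAt e false (U 1))) (b01 := secAt e' true (secAt e false
      (U 1))) (b10 := secAt e' false (secAt e false (U 1))) (b11 := secAt e' true (secAt e false (U 1))) (W := U 2) (hup 0 false false) (hup 0 false true)
      (hup 0 false false) (hup 0 false true) (hup 1 false false) (hup 1 false true) (hup 1 false false) (hup 1 false true) hW (hmon_e' 0 false) subset_rfl
      subset_rfl (hmon_e' 0 false) (hmon_e' 1 false) subset_rfl subset_rfl (hmon_e' 1 false) hdisj (hdS false false) (hdS false true) (hdS false false) (hdS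
      false true) (hdT false false) (hdT false true) (hdT false false) (hdT false true)
    have e2 : ((2 * μ⟦p, secAt e' false (secAt e false (U 0)) ∩ secAt e' false (secAt e false (U 1)) ∩ U 2⟧ + 2 * μ⟦p, secAt e' true (secAt e false (U 0)) ∩ secAt
        e' true (secAt e false (U 1)) ∩ U 2⟧ - μ⟦p, secAt e' false (secAt e false (U 0))⟧ * μ⟦p, secAt e' true (secAt e false (U 1)) ∩ U 2⟧ - μ⟦p, secAt e'
        true (secAt e false (U 0))⟧ * μ⟦p, secAt e' false (secAt e false (U 1)) ∩ U 2⟧ - μ⟦p, secAt e' false (secAt e false (U 1))⟧ * μ⟦p, secAt e' true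
        (secAt e false (U 0)) ∩ U 2⟧ - μ⟦p, secAt e' true (secAt e false (U 1))⟧ * μ⟦p, secAt e' false (secAt e false (U 0)) ∩ U 2⟧ - μ⟦p, U 2⟧ * (μ⟦p, secAt
        e' false (secAt e false (U 0))⟧ - μ⟦p, secAt e' true (secAt e false (U 0))⟧) * (μ⟦p, secAt e' false (secAt e false (U 1))⟧ - μ⟦p, secAt e' true (secAt
        e false (U 1))⟧)) + (2 * μ⟦p, secAt e' true (secAt e false (U 0)) ∩ secAt e' true (secAt e false (U 1)) ∩ U 2⟧ + 2 * μ⟦p, secAt e' false (secAt e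
        false (U 0)) ∩ secAt e' false (secAt e false (U 1)) ∩ U 2⟧ - μ⟦p, secAt e' true (secAt e false (U 0))⟧ * μ⟦p, secAt e' false (secAt e false (U 1)) ∩ U
        2⟧ - μ⟦p, secAt e' false (secAt e false (U 0))⟧ * μ⟦p, secAt e' true (secAt e false (U 1)) ∩ U 2⟧ - μ⟦p, secAt e' true (secAt e false (U 1))⟧ * μ⟦p,
        secAt e' false (secAt e false (U 0)) ∩ U 2⟧ - μ⟦p, secAt e' false (secAt e false (U 1))⟧ * μ⟦p, secAt e' true (secAt e false (U 0)) ∩ U 2⟧ - μ⟦p, U 2⟧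
        * (μ⟦p, secAt e' true (secAt e false (U 0))⟧ - μ⟦p, secAt e' false (secAt e false (U 0))⟧) * (μ⟦p, secAt e' true (secAt e false (U 1))⟧ - μ⟦p, secAt
        e' false (secAt e false (U 1))⟧)))
        = 2 * (2 * μ⟦p, secAt e' false (secAt e false (U 0)) ∩ secAt e' false (secAt e false (U 1)) ∩ U 2⟧ + 2 * μ⟦p, secAt e' true (secAt e false (U 0)) ∩ secAt e'
        true (secAt e false (U 1)) ∩ U 2⟧ - μ⟦p, secAt e' false (secAt e false (U 0))⟧ * μ⟦p, secAt e' true (secAt e false (U 1)) ∩ U 2⟧ - μ⟦p, secAt e' true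
        (secAt e false (U 0))⟧ * μ⟦p, secAt e' false (secAt e false (U 1)) ∩ U 2⟧ - μ⟦p, secAt e' false (secAt e false (U 1))⟧ * μ⟦p, secAt e' true (secAt e
        false (U 0)) ∩ U 2⟧ - μ⟦p, secAt e' true (secAt e false (U 1))⟧ * μ⟦p, secAt e' false (secAt e false (U 0)) ∩ U 2⟧ - μ⟦p, U 2⟧ * (μ⟦p, secAt e' false
        (secAt e false (U 0))⟧ - μ⟦p, secAt e' true (secAt e false (U 0))⟧) * (μ⟦p, secAt e' false (secAt e false (U 1))⟧ - μ⟦p, secAt e' true (secAt e false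
        (U 1))⟧)) := by ring
    rw [e2] at h
    linarith
  have hT_10_11 : 0 ≤ (2 * μ⟦p, secAt e' false (secAt e true (U 0)) ∩ secAt e' false (secAt e true (U 1)) ∩ U 2⟧ + 2 * μ⟦p, secAt e' true (secAt e true (U 0)) ∩ secAt e'
      true (secAt e true (U 1)) ∩ U 2⟧ - μ⟦p, secAt e' false (secAt e true (U 0))⟧ * μ⟦p, secAt e' true (secAt e true (U 1)) ∩ U 2⟧ - μ⟦p, secAt e' true
      (secAt e true (U 0))⟧ * μ⟦p, secAt e' false (secAt e true (U 1)) ∩ U 2⟧ - μ⟦p, secAt e' false (secAt e true (U 1))⟧ * μ⟦p, secAt e' true (secAt e true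
      (U 0)) ∩ U 2⟧ - μ⟦p, secAt e' true (secAt e true (U 1))⟧ * μ⟦p, secAt e' false (secAt e true (U 0)) ∩ U 2⟧ - μ⟦p, U 2⟧ * (μ⟦p, secAt e' false (secAt e
      true (U 0))⟧ - μ⟦p, secAt e' true (secAt e true (U 0))⟧) * (μ⟦p, secAt e' false (secAt e true (U 1))⟧ - μ⟦p, secAt e' true (secAt e true (U 1))⟧)) := by
    have h := cross_nonneg_of_determinedBy p (a00 := secAt e' false (secAt e true (U 0))) (a01 := secAt e' true (secAt e true (U 0))) (a10 := secAt e' false (secAt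
      e true (U 0))) (a11 := secAt e' true (secAt e true (U 0))) (b00 := secAt e' false (secAt e true (U 1))) (b01 := secAt e' true (secAt e true (U 1)))
      (b10 := secAt e' false (secAt e true (U 1))) (b11 := secAt e' true (secAt e true (U 1))) (W := U 2) (hup 0 true false) (hup 0 true true) (hup 0 true
      false) (hup 0 true true) (hup 1 true false) (hup 1 true true) (hup 1 true false) (hup 1 true true) hW (hmon_e' 0 true) subset_rfl subset_rfl (hmon_e'
      0 true) (hmon_e' 1 true) subset_rfl subset_rfl (hmon_e' 1 true) hdisj (hdS true false) (hdS true true) (hdS true false) (hdS true true) (hdT true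
      false) (hdT true true) (hdT true false) (hdT true true)
    have e2 : ((2 * μ⟦p, secAt e' false (secAt e true (U 0)) ∩ secAt e' false (secAt e true (U 1)) ∩ U 2⟧ + 2 * μ⟦p, secAt e' true (secAt e true (U 0)) ∩ secAt e'
        true (secAt e true (U 1)) ∩ U 2⟧ - μ⟦p, secAt e' false (secAt e true (U 0))⟧ * μ⟦p, secAt e' true (secAt e true (U 1)) ∩ U 2⟧ - μ⟦p, secAt e' true
        (secAt e true (U 0))⟧ * μ⟦p, secAt e' false (secAt e true (U 1)) ∩ U 2⟧ - μ⟦p, secAt e' false (secAt e true (U 1))⟧ * μ⟦p, secAt e' true (secAt e true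
        (U 0)) ∩ U 2⟧ - μ⟦p, secAt e' true (secAt e true (U 1))⟧ * μ⟦p, secAt e' false (secAt e true (U 0)) ∩ U 2⟧ - μ⟦p, U 2⟧ * (μ⟦p, secAt e' false (secAt e
        true (U 0))⟧ - μ⟦p, secAt e' true (secAt e true (U 0))⟧) * (μ⟦p, secAt e' false (secAt e true (U 1))⟧ - μ⟦p, secAt e' true (secAt e true (U 1))⟧)) +
        (2 * μ⟦p, secAt e' true (secAt e true (U 0)) ∩ secAt e' true (secAt e true (U 1)) ∩ U 2⟧ + 2 * μ⟦p, secAt e' false (secAt e true (U 0)) ∩ secAt e'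
        false (secAt e true (U 1)) ∩ U 2⟧ - μ⟦p, secAt e' true (secAt e true (U 0))⟧ * μ⟦p, secAt e' false (secAt e true (U 1)) ∩ U 2⟧ - μ⟦p, secAt e' false
        (secAt e true (U 0))⟧ * μ⟦p, secAt e' true (secAt e true (U 1)) ∩ U 2⟧ - μ⟦p, secAt e' true (secAt e true (U 1))⟧ * μ⟦p, secAt e' false (secAt e true
        (U 0)) ∩ U 2⟧ - μ⟦p, secAt e' false (secAt e true (U 1))⟧ * μ⟦p, secAt e' true (secAt e true (U 0)) ∩ U 2⟧ - μ⟦p, U 2⟧ * (μ⟦p, secAt e' true (secAt e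
        true (U 0))⟧ - μ⟦p, secAt e' false (secAt e true (U 0))⟧) * (μ⟦p, secAt e' true (secAt e true (U 1))⟧ - μ⟦p, secAt e' false (secAt e true (U 1))⟧)))
        = 2 * (2 * μ⟦p, secAt e' false (secAt e true (U 0)) ∩ secAt e' false (secAt e true (U 1)) ∩ U 2⟧ + 2 * μ⟦p, secAt e' true (secAt e true (U 0)) ∩ secAt e'
        true (secAt e true (U 1)) ∩ U 2⟧ - μ⟦p, secAt e' false (secAt e true (U 0))⟧ * μ⟦p, secAt e' true (secAt e true (U 1)) ∩ U 2⟧ - μ⟦p, secAt e' true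
        (secAt e true (U 0))⟧ * μ⟦p, secAt e' false (secAt e true (U 1)) ∩ U 2⟧ - μ⟦p, secAt e' false (secAt e true (U 1))⟧ * μ⟦p, secAt e' true (secAt e true
        (U 0)) ∩ U 2⟧ - μ⟦p, secAt e' true (secAt e true (U 1))⟧ * μ⟦p, secAt e' false (secAt e true (U 0)) ∩ U 2⟧ - μ⟦p, U 2⟧ * (μ⟦p, secAt e' false (secAt e
        true (U 0))⟧ - μ⟦p, secAt e' true (secAt e true (U 0))⟧) * (μ⟦p, secAt e' false (secAt e true (U 1))⟧ - μ⟦p, secAt e' true (secAt e true (U 1))⟧)) := by ring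
    rw [e2] at h
    linarith
  have hT_00_10 : 0 ≤ (2 * μ⟦p, secAt e' false (secAt e false (U 0)) ∩ secAt e' false (secAt e false (U 1)) ∩ U 2⟧ + 2 * μ⟦p, secAt e' false (secAt e true (U 0)) ∩ secAt e'
      false (secAt e true (U 1)) ∩ U 2⟧ - μ⟦p, secAt e' false (secAt e false (U 0))⟧ * μ⟦p, secAt e' false (secAt e true (U 1)) ∩ U 2⟧ - μ⟦p, secAt e' false
      (secAt e true (U 0))⟧ * μ⟦p, secAt e' false (secAt e false (U 1)) ∩ U 2⟧ - μ⟦p, secAt e' false (secAt e false (U 1))⟧ * μ⟦p, secAt e' false (secAt e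
      true (U 0)) ∩ U 2⟧ - μ⟦p, secAt e' false (secAt e true (U 1))⟧ * μ⟦p, secAt e' false (secAt e false (U 0)) ∩ U 2⟧ - μ⟦p, U 2⟧ * (μ⟦p, secAt e' false
      (secAt e false (U 0))⟧ - μ⟦p, secAt e' false (secAt e true (U 0))⟧) * (μ⟦p, secAt e' false (secAt e false (U 1))⟧ - μ⟦p, secAt e' false (secAt e true
      (U 1))⟧)) := by
    have h := cross_nonneg_of_determinedBy p (a00 := secAt e' false (secAt e false (U 0))) (a01 := secAt e' false (secAt e false (U 0))) (a10 := secAt e' false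
      (secAt e true (U 0))) (a11 := secAt e' false (secAt e true (U 0))) (b00 := secAt e' false (secAt e false (U 1))) (b01 := secAt e' false (secAt e false
      (U 1))) (b10 := secAt e' false (secAt e true (U 1))) (b11 := secAt e' false (secAt e true (U 1))) (W := U 2) (hup 0 false false) (hup 0 false false)
      (hup 0 true false) (hup 0 true false) (hup 1 false false) (hup 1 false false) (hup 1 true false) (hup 1 true false) hW subset_rfl (hmon_e 0 false)
      (hmon_e 0 false) subset_rfl subset_rfl (hmon_e 1 false) (hmon_e 1 false) subset_rfl hdisj (hdS false false) (hdS false false) (hdS true false) (hdS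
      true false) (hdT false false) (hdT false false) (hdT true false) (hdT true false)
    have e2 : ((2 * μ⟦p, secAt e' false (secAt e false (U 0)) ∩ secAt e' false (secAt e false (U 1)) ∩ U 2⟧ + 2 * μ⟦p, secAt e' false (secAt e true (U 0)) ∩ secAt
        e' false (secAt e true (U 1)) ∩ U 2⟧ - μ⟦p, secAt e' false (secAt e false (U 0))⟧ * μ⟦p, secAt e' false (secAt e true (U 1)) ∩ U 2⟧ - μ⟦p, secAt e'
        false (secAt e true (U 0))⟧ * μ⟦p, secAt e' false (secAt e false (U 1)) ∩ U 2⟧ - μ⟦p, secAt e' false (secAt e false (U 1))⟧ * μ⟦p, secAt e' false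
        (secAt e true (U 0)) ∩ U 2⟧ - μ⟦p, secAt e' false (secAt e true (U 1))⟧ * μ⟦p, secAt e' false (secAt e false (U 0)) ∩ U 2⟧ - μ⟦p, U 2⟧ * (μ⟦p, secAt
        e' false (secAt e false (U 0))⟧ - μ⟦p, secAt e' false (secAt e true (U 0))⟧) * (μ⟦p, secAt e' false (secAt e false (U 1))⟧ - μ⟦p, secAt e' false
        (secAt e true (U 1))⟧)) + (2 * μ⟦p, secAt e' false (secAt e false (U 0)) ∩ secAt e' false (secAt e false (U 1)) ∩ U 2⟧ + 2 * μ⟦p, secAt e' false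
        (secAt e true (U 0)) ∩ secAt e' false (secAt e true (U 1)) ∩ U 2⟧ - μ⟦p, secAt e' false (secAt e false (U 0))⟧ * μ⟦p, secAt e' false (secAt e true (U
        1)) ∩ U 2⟧ - μ⟦p, secAt e' false (secAt e true (U 0))⟧ * μ⟦p, secAt e' false (secAt e false (U 1)) ∩ U 2⟧ - μ⟦p, secAt e' false (secAt e false (U 1))⟧
        * μ⟦p, secAt e' false (secAt e true (U 0)) ∩ U 2⟧ - μ⟦p, secAt e' false (secAt e true (U 1))⟧ * μ⟦p, secAt e' false (secAt e false (U 0)) ∩ U 2⟧ -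
        μ⟦p, U 2⟧ * (μ⟦p, secAt e' false (secAt e false (U 0))⟧ - μ⟦p, secAt e' false (secAt e true (U 0))⟧) * (μ⟦p, secAt e' false (secAt e false (U 1))⟧ -
        μ⟦p, secAt e' false (secAt e true (U 1))⟧)))
        = 2 * (2 * μ⟦p, secAt e' false (secAt e false (U 0)) ∩ secAt e' false (secAt e false (U 1)) ∩ U 2⟧ + 2 * μ⟦p, secAt e' false (secAt e true (U 0)) ∩ secAt e'
        false (secAt e true (U 1)) ∩ U 2⟧ - μ⟦p, secAt e' false (secAt e false (U 0))⟧ * μ⟦p, secAt e' false (secAt e true (U 1)) ∩ U 2⟧ - μ⟦p, secAt e' false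
        (secAt e true (U 0))⟧ * μ⟦p, secAt e' false (secAt e false (U 1)) ∩ U 2⟧ - μ⟦p, secAt e' false (secAt e false (U 1))⟧ * μ⟦p, secAt e' false (secAt e
        true (U 0)) ∩ U 2⟧ - μ⟦p, secAt e' false (secAt e true (U 1))⟧ * μ⟦p, secAt e' false (secAt e false (U 0)) ∩ U 2⟧ - μ⟦p, U 2⟧ * (μ⟦p, secAt e' false
        (secAt e false (U 0))⟧ - μ⟦p, secAt e' false (secAt e true (U 0))⟧) * (μ⟦p, secAt e' false (secAt e false (U 1))⟧ - μ⟦p, secAt e' false (secAt e true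
        (U 1))⟧)) := by ring
    rw [e2] at h
    linarith
  have hT_01_11 : 0 ≤ (2 * μ⟦p, secAt e' true (secAt e false (U 0)) ∩ secAt e' true (secAt e false (U 1)) ∩ U 2⟧ + 2 * μ⟦p, secAt e' true (secAt e true (U 0)) ∩ secAt e'
      true (secAt e true (U 1)) ∩ U 2⟧ - μ⟦p, secAt e' true (secAt e false (U 0))⟧ * μ⟦p, secAt e' true (secAt e true (U 1)) ∩ U 2⟧ - μ⟦p, secAt e' true
      (secAt e true (U 0))⟧ * μ⟦p, secAt e' true (secAt e false (U 1)) ∩ U 2⟧ - μ⟦p, secAt e' true (secAt e false (U 1))⟧ * μ⟦p, secAt e' true (secAt e true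
      (U 0)) ∩ U 2⟧ - μ⟦p, secAt e' true (secAt e true (U 1))⟧ * μ⟦p, secAt e' true (secAt e false (U 0)) ∩ U 2⟧ - μ⟦p, U 2⟧ * (μ⟦p, secAt e' true (secAt e
      false (U 0))⟧ - μ⟦p, secAt e' true (secAt e true (U 0))⟧) * (μ⟦p, secAt e' true (secAt e false (U 1))⟧ - μ⟦p, secAt e' true (secAt e true (U 1))⟧)) := by
    have h := cross_nonneg_of_determinedBy p (a00 := secAt e' true (secAt e false (U 0))) (a01 := secAt e' true (secAt e false (U 0))) (a10 := secAt e' true (secAt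
      e true (U 0))) (a11 := secAt e' true (secAt e true (U 0))) (b00 := secAt e' true (secAt e false (U 1))) (b01 := secAt e' true (secAt e false (U 1)))
      (b10 := secAt e' true (secAt e true (U 1))) (b11 := secAt e' true (secAt e true (U 1))) (W := U 2) (hup 0 false true) (hup 0 false true) (hup 0 true
      true) (hup 0 true true) (hup 1 false true) (hup 1 false true) (hup 1 true true) (hup 1 true true) hW subset_rfl (hmon_e 0 true) (hmon_e 0 true)
      subset_rfl subset_rfl (hmon_e 1 true) (hmon_e 1 true) subset_rfl hdisj (hdS false true) (hdS false true) (hdS true true) (hdS true true) (hdT false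
      true) (hdT false true) (hdT true true) (hdT true true)
    have e2 : ((2 * μ⟦p, secAt e' true (secAt e false (U 0)) ∩ secAt e' true (secAt e false (U 1)) ∩ U 2⟧ + 2 * μ⟦p, secAt e' true (secAt e true (U 0)) ∩ secAt e'
        true (secAt e true (U 1)) ∩ U 2⟧ - μ⟦p, secAt e' true (secAt e false (U 0))⟧ * μ⟦p, secAt e' true (secAt e true (U 1)) ∩ U 2⟧ - μ⟦p, secAt e' true
        (secAt e true (U 0))⟧ * μ⟦p, secAt e' true (secAt e false (U 1)) ∩ U 2⟧ - μ⟦p, secAt e' true (secAt e false (U 1))⟧ * μ⟦p, secAt e' true (secAt e true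
        (U 0)) ∩ U 2⟧ - μ⟦p, secAt e' true (secAt e true (U 1))⟧ * μ⟦p, secAt e' true (secAt e false (U 0)) ∩ U 2⟧ - μ⟦p, U 2⟧ * (μ⟦p, secAt e' true (secAt e
        false (U 0))⟧ - μ⟦p, secAt e' true (secAt e true (U 0))⟧) * (μ⟦p, secAt e' true (secAt e false (U 1))⟧ - μ⟦p, secAt e' true (secAt e true (U 1))⟧)) +
        (2 * μ⟦p, secAt e' true (secAt e false (U 0)) ∩ secAt e' true (secAt e false (U 1)) ∩ U 2⟧ + 2 * μ⟦p, secAt e' true (secAt e true (U 0)) ∩ secAt e'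
        true (secAt e true (U 1)) ∩ U 2⟧ - μ⟦p, secAt e' true (secAt e false (U 0))⟧ * μ⟦p, secAt e' true (secAt e true (U 1)) ∩ U 2⟧ - μ⟦p, secAt e' true
        (secAt e true (U 0))⟧ * μ⟦p, secAt e' true (secAt e false (U 1)) ∩ U 2⟧ - μ⟦p, secAt e' true (secAt e false (U 1))⟧ * μ⟦p, secAt e' true (secAt e true
        (U 0)) ∩ U 2⟧ - μ⟦p, secAt e' true (secAt e true (U 1))⟧ * μ⟦p, secAt e' true (secAt e false (U 0)) ∩ U 2⟧ - μ⟦p, U 2⟧ * (μ⟦p, secAt e' true (secAt e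
        false (U 0))⟧ - μ⟦p, secAt e' true (secAt e true (U 0))⟧) * (μ⟦p, secAt e' true (secAt e false (U 1))⟧ - μ⟦p, secAt e' true (secAt e true (U 1))⟧)))
        = 2 * (2 * μ⟦p, secAt e' true (secAt e false (U 0)) ∩ secAt e' true (secAt e false (U 1)) ∩ U 2⟧ + 2 * μ⟦p, secAt e' true (secAt e true (U 0)) ∩ secAt e'
        true (secAt e true (U 1)) ∩ U 2⟧ - μ⟦p, secAt e' true (secAt e false (U 0))⟧ * μ⟦p, secAt e' true (secAt e true (U 1)) ∩ U 2⟧ - μ⟦p, secAt e' true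
        (secAt e true (U 0))⟧ * μ⟦p, secAt e' true (secAt e false (U 1)) ∩ U 2⟧ - μ⟦p, secAt e' true (secAt e false (U 1))⟧ * μ⟦p, secAt e' true (secAt e true
        (U 0)) ∩ U 2⟧ - μ⟦p, secAt e' true (secAt e true (U 1))⟧ * μ⟦p, secAt e' true (secAt e false (U 0)) ∩ U 2⟧ - μ⟦p, U 2⟧ * (μ⟦p, secAt e' true (secAt e
        false (U 0))⟧ - μ⟦p, secAt e' true (secAt e true (U 0))⟧) * (μ⟦p, secAt e' true (secAt e false (U 1))⟧ - μ⟦p, secAt e' true (secAt e true (U 1))⟧)) := by ring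
    rw [e2] at h
    linarith
  have c0 := mul_nonneg (mul_nonneg (pow_nonneg (sub_nonneg.2 hs1) 2) (pow_nonneg (sub_nonneg.2 ht1) 2)) hD_00
  have c1 := mul_nonneg (mul_nonneg (pow_nonneg (sub_nonneg.2 hs1) 2) (pow_nonneg ht0 2)) hD_01
  have c2 := mul_nonneg (mul_nonneg (pow_nonneg hs0 2) (pow_nonneg (sub_nonneg.2 ht1) 2)) hD_10
  have c3 := mul_nonneg (mul_nonneg (pow_nonneg hs0 2) (pow_nonneg ht0 2)) hD_11
  have c4 := mul_nonneg (mul_nonneg (pow_nonneg (sub_nonneg.2 hs1) 2) (mul_nonneg ht0 (sub_nonneg.2 ht1))) hT_00_01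
  have c5 := mul_nonneg (mul_nonneg (pow_nonneg hs0 2) (mul_nonneg ht0 (sub_nonneg.2 ht1))) hT_10_11
  have c6 := mul_nonneg (mul_nonneg (mul_nonneg hs0 (sub_nonneg.2 hs1)) (pow_nonneg (sub_nonneg.2 ht1) 2)) hT_00_10
  have c7 := mul_nonneg (mul_nonneg (mul_nonneg hs0 (sub_nonneg.2 hs1)) (pow_nonneg ht0 2)) hT_01_11
  have c8 := mul_nonneg (mul_nonneg (mul_nonneg hs0 (sub_nonneg.2 hs1)) (mul_nonneg ht0 (sub_nonneg.2 ht1))) hX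
  linarith

/-- **`C₃` for supports meeting in at most two coordinates, support form.**  `U₀` determined by `S`, `U₁` by `T`, `U₂` by `R`,
with `S ∩ T ⊆ {e, e'}` and `e, e' ∉ R`: `E_3(μ_p; 1_{U₀},1_{U₁},1_{U₂}) ≥ 0`. [this work] -/
theorem sahiE_three_ind_nonneg_of_supports₂' (p : ι → unitInterval) (e e' : ι) {U : Fin 3 → Set (Set ι)}
    (hU : ∀ j, IsUpperSet (U j)) {S T R : Finset ι} (hS : DeterminedBy (U 0) (↑S : Set ι))
    (hT : DeterminedBy (U 1) (↑T : Set ι)) (hR : DeterminedBy (U 2) (↑R : Set ι)) (hST : S ∩ T ⊆ {e, e'})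
    (he : e ∉ R) (he' : e' ∉ R) :
    0 ≤ sahiE (bernoulliWeight p) 3 (fun j => ind (U j)) :=
  sahiE_three_ind_nonneg_of_supports₂ p e e' hU hS hT hST
    (fun c => SahiCombJunta.secAt_eq_self_of_determinedBy hR (fun h => he (Finset.mem_coe.1 h)) c)
    (fun c => SahiCombJunta.secAt_eq_self_of_determinedBy hR (fun h => he' (Finset.mem_coe.1 h)) c)

end CrossOrbit

end Summit.CriticalPhenomena.PercolationContinuityZ3.Theorems
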